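import Literature.NumberTheory.LFunctions.MertensErrorTermsMeanValueRHThetaTailParts
import Literature.NumberTheory.LFunctions.MertensFormula
import Mathlib.Analysis.SpecialFunctions.Pow.Asymptotics
import HarnessLib

/-!
# RH-EQUIVALENT literature, proof layer — «nothing here bears on the truth of RH»
# Zhao 2025, Corollary 1 for `i = 2` PROVED: under RH, `∫_{cX}^X E₂(x) dx > 0` for all large `X`, every `0 < c < ((2−B₁)/(2+B₁))²`

Proof companion of `MertensErrorTermsMeanValueRH.lean` (T. Zhao, Res. Number Theory 11 (2025) 62 =
arXiv:2411.18903 [bib: `Zhao2025MertensMean`]); theorems only, no definition, no named fact. The source's Corollary 1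
(RH-CONDITIONAL): «Assuming RH, for each `i ∈ {1, 2, 3}` and any positive constant `c < ((2−B₁)/(2+B₁))²` we have
`∫_{cX}^X E_i(x) dx > 0` for `X ≥ X₀(c)`», `B₁ = 2 + γ − log 4π` (the tree's `nicolasBeta`). The case `i = 1` is the tree's
`Zhao2025.cor1_E₁_of_RH` (`MertensErrorTermsMeanValueRHWindow.lean`); this file PROVES the case `i = 2`
(`Zhao2025.cor1_E₂_of_RH`), in the quantitative form `∫_{cX}^X E₂ ≥ κ √X/log X` (`κ = κ(c) > 0`) used by the sequel for `i = 3`.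

Route (the source's §2, "restating these arguments asymptotically"; termwise integration of the explicit formula is
replaced by integration by parts against the `θ`-tail `T(u) = ∫_u^∞ (θ − t)/t²` of `MertensErrorTermsMeanValueRHThetaTailParts`):
by (2.5) (`Zhao2025.integral_E₂_eq`) `∫_{cX}^X E₂ = cX·T₂(cX) − X·T₂(X)` with `T₂(y) = ∫_y^∞ (π − li)/t²`; by (2.6)
(`VonKochTransfer.primeCounting_sub_logIntegral_eq`, MV (13.5)) `(π − li)/t² = (θ − t)/(t² log t) + (J(t) + κ₀)/t²`,
`J(t) = ∫₂ᵗ (θ − u)/(u log² u)`, `κ₀ = 2/log 2 − li 2`; (★) `∫_y^∞ (θ − t)/(t² log t) = T(y)/log y − ∫_y^∞ T/(t log² t)`;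
under RH `|T(u)| ≤ C/√u` on `[2, ∞)` and `y T(y) ≤ (B₁ − 2 + ε)√y + 1`, `≥ −(B₁ + 2 + ε)√y − log 2π` for large `y`
(Rosser–Schoenfeld Lemma 7 exact + `ψ − θ ∼ √x`, `Zhao2025.mul_tail_le_of_RH'` / `neg_mul_tail_le_of_RH`), and
`|J(t)| ≤ C√t/log² t` (Lemma 6 of the source in asymptotic, two-sided form); whence
`(B₁ − 2 − ε)√y/log y·(−1) ≥ … `: precisely `y T₂(y) ≤ (B₁ − 2 + ε)√y/log y` and `y T₂(y) ≥ −(B₁ + 2 + ε)√y/log y`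
for large `y` (`Zhao2025.eventually_mul_piLiTail_le_of_RH`, `…le_mul_piLiTail_of_RH`), and positivity of the window as soon
as `(2 − B₁) > (2 + B₁)√c`.
-/

noncomputable section

open Filter Topology Set MeasureTheory Asymptotics
open scoped Real Chebyshev

namespace Literature.NumberTheory.LFunctions

namespace Zhao2025

open PsiTailIntegral NicolasJExplicit

/-! ### The `θ`-tail is `O(1/√u)` on `[2, ∞)` under RH -/

/-- **Under RH, `|T(u)| ≤ C/√u` for all `u ≥ 2`** (`T(u) = ∫_u^∞ (θ − t)/t²`): the tree's two-sided bounds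
`u T(u) ≤ B₁√u + 1` (`κ = 0`, `θ ≤ ψ`) and `u T(u) ≥ −(B₁ + 2C')√u − log 2π` (`ψ − θ ≤ C'√t`, Chebyshev).
[cite: Zhao2025MertensMean, §2 (proof of Cor 1)] -/
theorem exists_abs_tail_le_div_sqrt_of_RH (hRH : RiemannHypothesis) :
    ∃ C : ℝ, 0 < C ∧ ∀ u : ℝ, 2 ≤ u → |∫ t in Ioi u, (θ t - t) / t ^ 2| ≤ C / Real.sqrt u := by
  obtain ⟨C', hC'⟩ := Chebyshev.psi_sub_theta_le_mul_sqrt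
  have hL : 0 < Real.log (2 * π) := Real.log_pos (by linarith [Real.pi_gt_three])
  have hβ0 : 0 < nicolasBeta := by linarith [nicolasBeta_gt]
  refine ⟨nicolasBeta + 2 * |C'| + 1 + Real.log (2 * π), by positivity, fun u hu => ?_⟩
  set T : ℝ := ∫ t in Ioi u, (θ t - t) / t ^ 2 with hT
  have hu0 : 0 < u := by linarith
  have hs1 : 1 ≤ Real.sqrt u := by
    rw [show (1 : ℝ) = Real.sqrt 1 by simp]; exact Real.sqrt_le_sqrt (by linarith)
  have hs0 : 0 < Real.sqrt u := by linarith
  have hup := mul_tail_le_of_RH' hRH (κ := 0) hu (fun t _ => by simpa using Chebyshev.theta_le_psi t)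
  have hlow := neg_mul_tail_le_of_RH hRH (κ := |C'|) hu (fun t _ => (hC' t).trans
    (mul_le_mul_of_nonneg_right (le_abs_self C') (Real.sqrt_nonneg t)))
  have habs : 0 ≤ |C'| := abs_nonneg _
  have key : |u * T| ≤ (nicolasBeta + 2 * |C'| + 1 + Real.log (2 * π)) * Real.sqrt u := by
    rw [abs_le]
    constructor
    · nlinarith
    · nlinarith
  rw [abs_mul, abs_of_pos hu0] at key
  rw [le_div_iff₀ hs0]
  have hss : Real.sqrt u * Real.sqrt u = u := Real.mul_self_sqrt hu0.le
  nlinarith [abs_nonneg T]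

/-! ### `J(x) = ∫₂ˣ (θ − u)/(u log² u) du = O(√x/log² x)` under RH (the source's Lemma 6, asymptotically) -/

/-- **Under RH, `|J(x)| ≤ C√x/log² x` for all large `x`**, `J(x) = ∫₂ˣ (θ(u) − u)/(u log² u) du`: by parts
`J(x) = T(2)·2/log²2 − T(x)·x/log²x + ∫₂ˣ T·(1/log² − 2/log³)`, `|T(u)| ≤ C/√u`, and `∫_{e⁸}^x du/(√u log²u) ≤ 4√x/log²x`.
(The source's Lemma 6 is the one-sided explicit form `J(x) < (B₁ − 1.96)√x/log²x`.) [cite: Zhao2025MertensMean, §2 (Lemma 6)] -/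
theorem exists_eventually_abs_J_le_of_RH (hRH : RiemannHypothesis) :
    ∃ C : ℝ, 0 < C ∧ ∀ᶠ x : ℝ in atTop,
      |∫ u in (2 : ℝ)..x, (θ u - u) / (u * Real.log u ^ 2)| ≤ C * Real.sqrt x / Real.log x ^ 2 := by
  obtain ⟨C, hC0, hC⟩ := exists_abs_tail_le_div_sqrt_of_RH hRH
  set A : ℝ := ∫ t in Ioi 1, |(θ t - t) / t ^ 2| with hA
  set a : ℝ := Real.exp 8 with ha
  set T : ℝ → ℝ := fun u => ∫ t in Ioi u, (θ t - t) / t ^ 2 with hT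
  have hA0 : 0 ≤ A := by positivity
  have hl2 : 0 < Real.log 2 := Real.log_pos one_lt_two
  have ha2 : 2 < a := by
    have := Real.add_one_le_exp (8 : ℝ); rw [ha]; linarith
  set c₂ : ℝ := (Real.log 2 ^ 2)⁻¹ + 2 * (Real.log 2 ^ 3)⁻¹ with hc₂
  have hc₂0 : 0 ≤ c₂ := by positivity
  set K₀ : ℝ := A * (2 / Real.log 2 ^ 2) + A * c₂ * (a - 2) with hK₀
  have hK₀0 : 0 ≤ K₀ := by
    have : 0 ≤ a - 2 := by linarith
    positivity
  -- eventually `K₀ ≤ √x / log² x`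
  have hev : ∀ᶠ x : ℝ in atTop, K₀ * Real.log x ^ 2 ≤ Real.sqrt x := by
    have h := (isLittleO_log_rpow_rpow_atTop (2 : ℝ) (by norm_num : (0 : ℝ) < 1 / 2)).def
      (by positivity : (0 : ℝ) < 1 / (K₀ + 1))
    filter_upwards [h, eventually_ge_atTop (1 : ℝ)] with x hx hx1
    have hx0 : 0 ≤ x := by linarith
    rw [Real.rpow_two, Real.norm_of_nonneg (by positivity),
      Real.norm_of_nonneg (Real.rpow_nonneg hx0 _), ← Real.sqrt_eq_rpow] at hx
    have hs : 0 ≤ Real.sqrt x := Real.sqrt_nonneg x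
    have : (K₀ + 1) * Real.log x ^ 2 ≤ Real.sqrt x := by
      have := mul_le_mul_of_nonneg_left hx (by positivity : (0 : ℝ) ≤ K₀ + 1)
      rw [← mul_assoc, mul_one_div_cancel (by positivity : K₀ + 1 ≠ 0), one_mul] at this
      exact this
    nlinarith [sq_nonneg (Real.log x)]
  refine ⟨5 * C + 1, by positivity, ?_⟩
  filter_upwards [hev, eventually_ge_atTop a] with x hK hxa
  have hx2 : 2 ≤ x := ha2.le.trans hxa
  have hx0 : 0 < x := by linarith
  have hlx : 0 < Real.log x := Real.log_pos (by linarith)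
  have hsx : 0 < Real.sqrt x := Real.sqrt_pos.2 hx0
  have hssx : Real.sqrt x * Real.sqrt x = x := Real.mul_self_sqrt hx0.le
  rw [integral_theta_sub_div_mul_log_sq_eq_parts hx2]
  -- the two boundary terms
  have h1 : |T 2 * (2 / Real.log 2 ^ 2)| ≤ A * (2 / Real.log 2 ^ 2) := by
    rw [abs_mul, abs_of_pos (by positivity : (0 : ℝ) < 2 / Real.log 2 ^ 2)]
    exact mul_le_mul_of_nonneg_right (abs_tail_le (by norm_num)) (by positivity)
  have h2 : |T x * (x / Real.log x ^ 2)| ≤ C * Real.sqrt x / Real.log x ^ 2 := by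
    rw [abs_mul, abs_of_pos (by positivity : (0 : ℝ) < x / Real.log x ^ 2)]
    calc |T x| * (x / Real.log x ^ 2) ≤ C / Real.sqrt x * (x / Real.log x ^ 2) :=
          mul_le_mul_of_nonneg_right (hC x hx2) (by positivity)
      _ = C * Real.sqrt x / Real.log x ^ 2 := by
          field_simp
          nlinarith [hssx]
  -- the integral, split at `a = e⁸`
  have hφ'c : ∀ {p q : ℝ}, 2 ≤ p → p ≤ q →
      ContinuousOn (fun u : ℝ => (Real.log u ^ 2)⁻¹ - 2 * (Real.log u ^ 3)⁻¹) (uIcc p q) := by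
    intro p q hp hpq
    rw [uIcc_of_le hpq]
    refine continuousOn_of_forall_continuousAt fun u hu => ?_
    have hu1 : 1 < u := by linarith [hu.1]
    have hu0 : u ≠ 0 := by linarith
    have hl : Real.log u ≠ 0 := (Real.log_pos hu1).ne'
    have hl2' : Real.log u ^ 2 ≠ 0 := pow_ne_zero _ hl
    have hl3 : Real.log u ^ 3 ≠ 0 := pow_ne_zero _ hl
    fun_prop (disch := assumption)
  have hTi : ∀ {p q : ℝ}, 2 ≤ p → p ≤ q →
      IntervalIntegrable (fun u => T u * ((Real.log u ^ 2)⁻¹ - 2 * (Real.log u ^ 3)⁻¹)) volume p q := by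
    intro p q hp hpq
    refine (hφ'c hp hpq).intervalIntegrable.continuousOn_mul ?_
    rw [uIcc_of_le hpq]
    exact (continuousOn_tail_Icc q).mono (Icc_subset_Icc_left hp)
  rw [← intervalIntegral.integral_add_adjacent_intervals (hTi le_rfl ha2.le) (hTi ha2.le hxa)]
  have h3 : |∫ u in (2 : ℝ)..a, T u * ((Real.log u ^ 2)⁻¹ - 2 * (Real.log u ^ 3)⁻¹)| ≤ A * c₂ * (a - 2) := by
    have h := intervalIntegral.norm_integral_le_of_norm_le_const (a := 2) (b := a) (C := A * c₂)
      (f := fun u => T u * ((Real.log u ^ 2)⁻¹ - 2 * (Real.log u ^ 3)⁻¹)) fun u hu => ?_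
    · rw [Real.norm_eq_abs, abs_of_pos (by linarith : (0 : ℝ) < a - 2)] at h
      exact h
    rw [uIoc_of_le ha2.le] at hu
    have hu1 : 1 ≤ u := by linarith [hu.1]
    have hlu : Real.log 2 ≤ Real.log u := Real.log_le_log two_pos hu.1.le
    have hlu0 : 0 < Real.log u := hl2.trans_le hlu
    rw [norm_mul, Real.norm_eq_abs, Real.norm_eq_abs]
    refine mul_le_mul (abs_tail_le hu1) ?_ (abs_nonneg _) hA0
    calc |(Real.log u ^ 2)⁻¹ - 2 * (Real.log u ^ 3)⁻¹|
        ≤ |(Real.log u ^ 2)⁻¹| + |2 * (Real.log u ^ 3)⁻¹| := abs_sub _ _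
      _ = (Real.log u ^ 2)⁻¹ + 2 * (Real.log u ^ 3)⁻¹ := by
          rw [abs_of_pos (by positivity), abs_of_pos (by positivity)]
      _ ≤ c₂ := by
          rw [hc₂]
          gcongr
  have h4 : |∫ u in a..x, T u * ((Real.log u ^ 2)⁻¹ - 2 * (Real.log u ^ 3)⁻¹)| ≤
      4 * C * Real.sqrt x / Real.log x ^ 2 := by
    have hcont : ContinuousOn (fun u : ℝ => C * (Real.sqrt u * Real.log u ^ 2)⁻¹) (uIcc a x) := by
      rw [uIcc_of_le hxa]
      refine continuousOn_of_forall_continuousAt fun u hu => ?_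
      have hu0 : 0 < u := by linarith [hu.1]
      have hl : Real.log u ≠ 0 := (Real.log_pos (by linarith [hu.1])).ne'
      have h2' : Real.sqrt u * Real.log u ^ 2 ≠ 0 := mul_ne_zero (Real.sqrt_pos.2 hu0).ne' (pow_ne_zero _ hl)
      have hu0' : u ≠ 0 := hu0.ne'
      fun_prop (disch := assumption)
    have h := intervalIntegral.norm_integral_le_of_norm_le (μ := volume) hxa
      (f := fun u => T u * ((Real.log u ^ 2)⁻¹ - 2 * (Real.log u ^ 3)⁻¹))
      (g := fun u => C * (Real.sqrt u * Real.log u ^ 2)⁻¹) (Eventually.of_forall fun u hu => ?_) hcont.intervalIntegrable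
    · rw [Real.norm_eq_abs] at h
      refine h.trans ?_
      rw [intervalIntegral.integral_const_mul]
      have := integral_inv_sqrt_mul_log_sq_le le_rfl hxa
      calc C * ∫ u in a..x, (Real.sqrt u * Real.log u ^ 2)⁻¹ ≤ C * (4 * Real.sqrt x / Real.log x ^ 2) :=
            mul_le_mul_of_nonneg_left this hC0.le
        _ = 4 * C * Real.sqrt x / Real.log x ^ 2 := by ring
    have hu0 : 0 < u := by linarith [hu.1]
    have hl8 : 8 ≤ Real.log u := by
      rw [← Real.log_exp 8]; exact Real.log_le_log (Real.exp_pos _) hu.1.le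
    have hl : 0 < Real.log u := by linarith
    have hsu : 0 < Real.sqrt u := Real.sqrt_pos.2 hu0
    rw [norm_mul, Real.norm_eq_abs, Real.norm_eq_abs]
    have hφ' : |(Real.log u ^ 2)⁻¹ - 2 * (Real.log u ^ 3)⁻¹| ≤ (Real.log u ^ 2)⁻¹ := by
      have e : (Real.log u ^ 2)⁻¹ - 2 * (Real.log u ^ 3)⁻¹ = (Real.log u - 2) / Real.log u ^ 3 := by
        field_simp
      rw [e, abs_of_nonneg (div_nonneg (by linarith) (by positivity)), div_le_iff₀ (by positivity)]
      have : (Real.log u ^ 2)⁻¹ * Real.log u ^ 3 = Real.log u := by field_simp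
      rw [this]; linarith
    calc |T u| * |(Real.log u ^ 2)⁻¹ - 2 * (Real.log u ^ 3)⁻¹| ≤ C / Real.sqrt u * (Real.log u ^ 2)⁻¹ :=
          mul_le_mul (hC u (by linarith [hu.1])) hφ' (abs_nonneg _) (by positivity)
      _ = C * (Real.sqrt u * Real.log u ^ 2)⁻¹ := by field_simp
  -- assemble
  have hK' : K₀ ≤ Real.sqrt x / Real.log x ^ 2 := by rwa [le_div_iff₀ (by positivity)]
  calc |T 2 * (2 / Real.log 2 ^ 2) - T x * (x / Real.log x ^ 2) +
        ((∫ u in (2 : ℝ)..a, T u * ((Real.log u ^ 2)⁻¹ - 2 * (Real.log u ^ 3)⁻¹)) +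
          ∫ u in a..x, T u * ((Real.log u ^ 2)⁻¹ - 2 * (Real.log u ^ 3)⁻¹))|
      ≤ |T 2 * (2 / Real.log 2 ^ 2)| + |T x * (x / Real.log x ^ 2)| +
        (|∫ u in (2 : ℝ)..a, T u * ((Real.log u ^ 2)⁻¹ - 2 * (Real.log u ^ 3)⁻¹)| +
          |∫ u in a..x, T u * ((Real.log u ^ 2)⁻¹ - 2 * (Real.log u ^ 3)⁻¹)|) := by
        refine (abs_add_le _ _).trans (add_le_add (abs_sub _ _) (abs_add_le _ _))
    _ ≤ A * (2 / Real.log 2 ^ 2) + C * Real.sqrt x / Real.log x ^ 2 +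
        (A * c₂ * (a - 2) + 4 * C * Real.sqrt x / Real.log x ^ 2) := by gcongr
    _ = K₀ + 5 * C * (Real.sqrt x / Real.log x ^ 2) := by rw [hK₀]; ring
    _ ≤ Real.sqrt x / Real.log x ^ 2 + 5 * C * (Real.sqrt x / Real.log x ^ 2) := by linarith
    _ = (5 * C + 1) * Real.sqrt x / Real.log x ^ 2 := by ring

/-! ### The decomposition `(π − li)/t² = (θ − t)/(t² log t) + (J(t) + κ₀)/t²` and the size of its second part -/

/-- (2.6) divided by `t²`: for `t ≥ 2`,
`(π(t) − li(t))/t² − (θ(t) − t)/(t² log t) = (J(t) + 2/log 2 − li 2)/t²`, `J(t) = ∫₂ᵗ (θ − u)/(u log² u) du`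
(Montgomery–Vaughan (13.5), the tree's `VonKochTransfer.primeCounting_sub_logIntegral_eq`). [cite: Zhao2025MertensMean, §2 (2.6)] -/
theorem piLiKernel_sub_thetaKernel_div_log_eq {t : ℝ} (ht : 2 ≤ t) :
    ((Nat.primeCounting ⌊t⌋₊ : ℝ) - logIntegral t) / t ^ 2 - (θ t - t) / t ^ 2 * (Real.log t)⁻¹ =
      ((∫ u in (2 : ℝ)..t, (θ u - u) / (u * Real.log u ^ 2)) + (2 / Real.log 2 - logIntegral 2)) / t ^ 2 := by
  rw [VonKochTransfer.primeCounting_sub_logIntegral_eq ht]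
  have ht0 : t ≠ 0 := by linarith
  have hl : Real.log t ≠ 0 := (Real.log_pos (by linarith)).ne'
  field_simp
  ring

/-- **Under RH, `|∫_y^∞ [(π − li)/t² − (θ − t)/(t² log t)] dt| ≤ C/(√y log² y) + |κ₀|/y` for all large `y`**
(`κ₀ = 2/log 2 − li 2`; from `|J(t)| ≤ C'√t/log² t` and `∫_y^∞ t^{-3/2} = 2/√y`). [cite: Zhao2025MertensMean, §2 (proof of Thm 1 for E₂)] -/
theorem exists_abs_integral_piLiKernel_sub_le_of_RH (hRH : RiemannHypothesis) :
    ∃ C : ℝ, 0 < C ∧ ∃ y₀ : ℝ, 2 ≤ y₀ ∧ ∀ y : ℝ, y₀ ≤ y →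
      |∫ t in Ioi y, (((Nat.primeCounting ⌊t⌋₊ : ℝ) - logIntegral t) / t ^ 2 - (θ t - t) / t ^ 2 * (Real.log t)⁻¹)| ≤
        C / (Real.sqrt y * Real.log y ^ 2) + |2 / Real.log 2 - logIntegral 2| / y := by
  obtain ⟨C, hC0, hC⟩ := exists_eventually_abs_J_le_of_RH hRH
  obtain ⟨y₁, hy₁⟩ := hC.exists_forall_of_atTop
  set κ₀ : ℝ := 2 / Real.log 2 - logIntegral 2 with hκ₀
  refine ⟨2 * C, by positivity, max y₁ 2, le_max_right _ _, fun y hy => ?_⟩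
  have hy2 : 2 ≤ y := (le_max_right _ _).trans hy
  have hyy₁ : y₁ ≤ y := (le_max_left _ _).trans hy
  have hy0 : 0 < y := by linarith
  have hly : 0 < Real.log y := Real.log_pos (by linarith)
  have hsy : 0 < Real.sqrt y := Real.sqrt_pos.2 hy0
  -- the majorant and its integral
  set m : ℝ → ℝ := fun t => C / Real.log y ^ 2 * t ^ (-(3 / 2 : ℝ)) + |κ₀| * t ^ (-(2 : ℝ)) with hm
  have hmi : IntegrableOn m (Ioi y) :=
    ((integrableOn_Ioi_rpow_of_lt (by norm_num : (-(3 / 2 : ℝ)) < -1) hy0).const_mul _).add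
      ((integrableOn_Ioi_rpow_of_lt (by norm_num : (-(2 : ℝ)) < -1) hy0).const_mul _)
  have hmval : ∫ t in Ioi y, m t = 2 * C / (Real.sqrt y * Real.log y ^ 2) + |κ₀| / y := by
    rw [hm, integral_add ((integrableOn_Ioi_rpow_of_lt (by norm_num : (-(3 / 2 : ℝ)) < -1) hy0).const_mul _)
      ((integrableOn_Ioi_rpow_of_lt (by norm_num : (-(2 : ℝ)) < -1) hy0).const_mul _),
      integral_const_mul, integral_const_mul, integral_Ioi_rpow_of_lt (by norm_num) hy0,
      integral_Ioi_rpow_of_lt (by norm_num) hy0,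
      show (-(3 / 2 : ℝ) + 1) = -(1 / 2) by norm_num, show (-(2 : ℝ) + 1) = -1 by norm_num,
      Real.rpow_neg_one, Real.rpow_neg hy0.le, ← Real.sqrt_eq_rpow]
    field_simp
  have hbound : ∀ᵐ t ∂(volume.restrict (Ioi y)),
      ‖((Nat.primeCounting ⌊t⌋₊ : ℝ) - logIntegral t) / t ^ 2 - (θ t - t) / t ^ 2 * (Real.log t)⁻¹‖ ≤ m t := by
    rw [ae_restrict_iff' measurableSet_Ioi]
    refine Eventually.of_forall fun t ht => ?_
    have hty : y < t := ht
    have ht2 : 2 ≤ t := hy2.trans hty.le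
    have ht0 : 0 < t := by linarith
    have hlt : Real.log y ≤ Real.log t := Real.log_le_log hy0 hty.le
    have hlt0 : 0 < Real.log t := hly.trans_le hlt
    rw [piLiKernel_sub_thetaKernel_div_log_eq ht2, Real.norm_eq_abs, abs_div, abs_of_pos (by positivity : (0 : ℝ) < t ^ 2)]
    have hJ := hy₁ t (hyy₁.trans hty.le)
    have e32 : Real.sqrt t / t ^ 2 = t ^ (-(3 / 2 : ℝ)) := by
      rw [Real.sqrt_eq_rpow, show (t ^ 2 : ℝ) = t ^ (2 : ℝ) by norm_cast, ← Real.rpow_sub ht0]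
      norm_num
    have e2 : (t ^ 2)⁻¹ = t ^ (-(2 : ℝ)) := by
      rw [Real.rpow_neg ht0.le, show (t ^ (2 : ℝ) : ℝ) = t ^ (2 : ℕ) by norm_cast]
    calc |(∫ u in (2 : ℝ)..t, (θ u - u) / (u * Real.log u ^ 2)) + κ₀| / t ^ 2
        ≤ (C * Real.sqrt t / Real.log t ^ 2 + |κ₀|) / t ^ 2 :=
          div_le_div_of_nonneg_right ((abs_add_le _ _).trans (add_le_add hJ le_rfl)) (by positivity)
      _ ≤ (C * Real.sqrt t / Real.log y ^ 2 + |κ₀|) / t ^ 2 := by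
          gcongr
      _ = m t := by
          rw [hm]
          simp only
          rw [← e32, ← e2]
          field_simp
  have h := norm_integral_le_of_norm_le hmi hbound
  rw [Real.norm_eq_abs, hmval] at h
  exact h

/-- **Under RH, `|∫_y^∞ T(t) dt/(t log² t)| ≤ C/(√y log² y)` for `y ≥ 2`** (`|T(t)| ≤ C'/√t`).
[cite: Zhao2025MertensMean, §2 (proof of Thm 1 for E₂)] -/
theorem exists_abs_integral_tail_mul_le_of_RH (hRH : RiemannHypothesis) :
    ∃ C : ℝ, 0 < C ∧ ∀ y : ℝ, 2 ≤ y →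
      |∫ t in Ioi y, (∫ u in Ioi t, (θ u - u) / u ^ 2) * (t⁻¹ / Real.log t ^ 2)| ≤
        C / (Real.sqrt y * Real.log y ^ 2) := by
  obtain ⟨C, hC0, hC⟩ := exists_abs_tail_le_div_sqrt_of_RH hRH
  refine ⟨2 * C, by positivity, fun y hy2 => ?_⟩
  have hy0 : 0 < y := by linarith
  have hly : 0 < Real.log y := Real.log_pos (by linarith)
  set m : ℝ → ℝ := fun t => C / Real.log y ^ 2 * t ^ (-(3 / 2 : ℝ)) with hm
  have hmi : IntegrableOn m (Ioi y) :=
    (integrableOn_Ioi_rpow_of_lt (by norm_num : (-(3 / 2 : ℝ)) < -1) hy0).const_mul _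
  have hmval : ∫ t in Ioi y, m t = 2 * C / (Real.sqrt y * Real.log y ^ 2) := by
    rw [hm, integral_const_mul, integral_Ioi_rpow_of_lt (by norm_num) hy0,
      show (-(3 / 2 : ℝ) + 1) = -(1 / 2) by norm_num, Real.rpow_neg hy0.le, ← Real.sqrt_eq_rpow]
    field_simp
  have hbound : ∀ᵐ t ∂(volume.restrict (Ioi y)),
      ‖(∫ u in Ioi t, (θ u - u) / u ^ 2) * (t⁻¹ / Real.log t ^ 2)‖ ≤ m t := by
    rw [ae_restrict_iff' measurableSet_Ioi]
    refine Eventually.of_forall fun t ht => ?_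
    have hty : y < t := ht
    have ht2 : 2 ≤ t := hy2.trans hty.le
    have ht0 : 0 < t := by linarith
    have hlt : Real.log y ≤ Real.log t := Real.log_le_log hy0 hty.le
    have hlt0 : 0 < Real.log t := hly.trans_le hlt
    have hst : 0 < Real.sqrt t := Real.sqrt_pos.2 ht0
    rw [norm_mul, Real.norm_eq_abs, Real.norm_eq_abs, abs_of_pos (by positivity : (0 : ℝ) < t⁻¹ / Real.log t ^ 2)]
    have e32 : (Real.sqrt t)⁻¹ * t⁻¹ = t ^ (-(3 / 2 : ℝ)) := by
      rw [Real.sqrt_eq_rpow, ← Real.rpow_neg ht0.le, show (t⁻¹ : ℝ) = t ^ (-1 : ℝ) by rw [Real.rpow_neg_one],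
        ← Real.rpow_add ht0]
      norm_num
    calc |∫ u in Ioi t, (θ u - u) / u ^ 2| * (t⁻¹ / Real.log t ^ 2)
        ≤ C / Real.sqrt t * (t⁻¹ / Real.log y ^ 2) := by
          refine mul_le_mul (hC t ht2) ?_ (by positivity) (by positivity)
          gcongr
      _ = m t := by
          rw [hm]
          simp only
          rw [← e32]
          field_simp
  have h := norm_integral_le_of_norm_le hmi hbound
  rw [Real.norm_eq_abs, hmval] at h
  exact h

/-! ### Two-sided bounds for `y · ∫_y^∞ (π − li)/t²` under RH -/

/-- The tail `T₂(y) = ∫_y^∞ (π − li)/t²` decomposed: `T₂(y) = T(y)/log y − ∫_y^∞ T/(t log² t) + ∫_y^∞ (J + κ₀)/t²`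
(`y ≥ 2`). [cite: Zhao2025MertensMean, §2 (proof of Thm 1 for E₂)] -/
theorem piLiTail_eq {y : ℝ} (hy : 2 ≤ y) :
    ∫ t in Ioi y, ((Nat.primeCounting ⌊t⌋₊ : ℝ) - logIntegral t) / t ^ 2 =
      (∫ t in Ioi y, (θ t - t) / t ^ 2) * (Real.log y)⁻¹ -
        (∫ t in Ioi y, (∫ u in Ioi t, (θ u - u) / u ^ 2) * (t⁻¹ / Real.log t ^ 2)) +
        ∫ t in Ioi y, (((Nat.primeCounting ⌊t⌋₊ : ℝ) - logIntegral t) / t ^ 2 -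
          (θ t - t) / t ^ 2 * (Real.log t)⁻¹) := by
  rw [← integral_Ioi_thetaKernel_div_log_eq hy, integral_sub (integrableOn_piLiKernel.mono_set (Ioi_subset_Ioi hy))
    (integrableOn_thetaKernel_mul_inv_log hy)]
  ring

/-- `log y = o(√y)`: for every `a ≥ 0` and `b > 0`, `a · log y ≤ b · √y` for all large `y` (plumbing).
[cite: Zhao2025MertensMean, §2 (proof of Cor 1)] -/
theorem eventually_mul_log_le_mul_sqrt {a b : ℝ} (ha : 0 ≤ a) (hb : 0 < b) :
    ∀ᶠ y : ℝ in atTop, a * Real.log y ≤ b * Real.sqrt y := by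
  have h := (isLittleO_log_rpow_atTop (by norm_num : (0 : ℝ) < 1 / 2)).def
    (by positivity : (0 : ℝ) < b / (a + 1))
  filter_upwards [h, eventually_ge_atTop (1 : ℝ)] with y hy hy1
  rw [Real.norm_of_nonneg (Real.log_nonneg hy1), Real.norm_of_nonneg (Real.rpow_nonneg (by linarith) _),
    ← Real.sqrt_eq_rpow] at hy
  have hs : 0 ≤ Real.sqrt y := Real.sqrt_nonneg y
  calc a * Real.log y ≤ a * (b / (a + 1) * Real.sqrt y) := mul_le_mul_of_nonneg_left hy ha
    _ = (a / (a + 1)) * (b * Real.sqrt y) := by field_simp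
    _ ≤ 1 * (b * Real.sqrt y) :=
        mul_le_mul_of_nonneg_right ((div_le_one (by positivity)).2 (by linarith)) (by positivity)
    _ = b * Real.sqrt y := one_mul _

/-- **Upper bound under RH**: for every `ε > 0`, `y ∫_y^∞ (π − li)/t² ≤ (B₁ − 2 + ε)√y/log y` for all large `y`
(the source's `∫_X^∞ (π − li)/x² < −1.73/(√X log X)`, asymptotically with the exact constant `B₁ − 2`).
[cite: Zhao2025MertensMean, §2 (last display of the proof of Thm 1, sufficiency)] -/
theorem eventually_mul_piLiTail_le_of_RH (hRH : RiemannHypothesis) {ε : ℝ} (hε : 0 < ε) :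
    ∀ᶠ y : ℝ in atTop,
      y * ∫ t in Ioi y, ((Nat.primeCounting ⌊t⌋₊ : ℝ) - logIntegral t) / t ^ 2 ≤
        (nicolasBeta - 2 + ε) * Real.sqrt y / Real.log y := by
  obtain ⟨C₁, hC₁0, hC₁⟩ := exists_abs_integral_tail_mul_le_of_RH hRH
  obtain ⟨C₂, hC₂0, y₀, hy₀2, hC₂⟩ := exists_abs_integral_piLiKernel_sub_le_of_RH hRH
  set κ : ℝ := |2 / Real.log 2 - logIntegral 2| with hκ
  have hκ0 : 0 ≤ κ := abs_nonneg _
  have hε3 : 0 < ε / 3 := by positivity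
  -- `ψ − θ ≥ (1 − ε/3)√t` beyond `T₁`
  obtain ⟨T₁, hT₁⟩ := (eventually_le_psi_sub_theta hε3).exists_forall_of_atTop
  filter_upwards [eventually_ge_atTop (max T₁ 2), eventually_ge_atTop y₀,
    eventually_mul_log_le_mul_sqrt hκ0 (by positivity : 0 < ε / 9),
    tendsto_sqrt_atTop.eventually_ge_atTop (9 / ε),
    Real.tendsto_log_atTop.eventually_ge_atTop (9 * (C₁ + C₂) / ε)] with y hyT hyy₀ hyl hsε hLε
  have hy2 : 2 ≤ y := (le_max_right _ _).trans hyT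
  have hy0 : 0 < y := by linarith
  set s : ℝ := Real.sqrt y with hs
  set L : ℝ := Real.log y with hL
  have hs0 : 0 < s := Real.sqrt_pos.2 hy0
  have hL0 : 0 < L := Real.log_pos (by linarith)
  have hyss : y = s * s := (Real.mul_self_sqrt hy0.le).symm
  set T : ℝ := ∫ t in Ioi y, (θ t - t) / t ^ 2 with hT
  set IT : ℝ := ∫ t in Ioi y, (∫ u in Ioi t, (θ u - u) / u ^ 2) * (t⁻¹ / Real.log t ^ 2) with hIT
  set IK : ℝ := ∫ t in Ioi y, (((Nat.primeCounting ⌊t⌋₊ : ℝ) - logIntegral t) / t ^ 2 -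
    (θ t - t) / t ^ 2 * (Real.log t)⁻¹) with hIK
  rw [piLiTail_eq hy2]
  -- the three pieces
  have hTy : y * T ≤ (nicolasBeta - 2 * (1 - ε / 3)) * s + 1 :=
    mul_tail_le_of_RH' hRH (κ := 1 - ε / 3) hy2 (fun t ht => hT₁ t ((le_max_left _ _).trans (hyT.trans ht)))
  have hITb : |IT| ≤ C₁ / (s * L ^ 2) := hC₁ y hy2
  have hIKb : |IK| ≤ C₂ / (s * L ^ 2) + κ / y := hC₂ y hyy₀
  have h1 : y * (T * L⁻¹) ≤ ((nicolasBeta - 2 * (1 - ε / 3)) * s + 1) / L := by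
    rw [← mul_assoc, ← div_eq_mul_inv]
    exact div_le_div_of_nonneg_right hTy hL0.le
  have h2 : -(y * IT) ≤ C₁ * s / L ^ 2 := by
    have : -IT ≤ C₁ / (s * L ^ 2) := (neg_le_abs IT).trans hITb
    calc -(y * IT) = y * (-IT) := by ring
      _ ≤ y * (C₁ / (s * L ^ 2)) := mul_le_mul_of_nonneg_left this hy0.le
      _ = C₁ * s / L ^ 2 := by rw [hyss]; field_simp
  have h3 : y * IK ≤ C₂ * s / L ^ 2 + κ := by
    have : IK ≤ C₂ / (s * L ^ 2) + κ / y := (le_abs_self IK).trans hIKb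
    calc y * IK ≤ y * (C₂ / (s * L ^ 2) + κ / y) := mul_le_mul_of_nonneg_left this hy0.le
      _ = C₂ * s / L ^ 2 + κ := by rw [hyss]; field_simp
  -- the remainders are `≤ (ε/9) s/L` each
  have r1 : 1 / L ≤ ε / 9 * s / L := by
    refine div_le_div_of_nonneg_right ?_ hL0.le
    have h := mul_le_mul_of_nonneg_left hsε hε3.le
    have e : ε / 3 * (9 / ε) = 3 := by field_simp; ring
    rw [e] at h
    linarith
  have r2 : (C₁ + C₂) * s / L ^ 2 ≤ ε / 9 * s / L := by
    have h : C₁ + C₂ ≤ ε / 9 * L := by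
      rw [div_le_iff₀ hε] at hLε
      linarith
    have e1 : (C₁ + C₂) * s / L ^ 2 = (C₁ + C₂) * (s / L ^ 2) := by ring
    have e2 : ε / 9 * s / L = (ε / 9 * L) * (s / L ^ 2) := by field_simp
    rw [e1, e2]
    exact mul_le_mul_of_nonneg_right h (by positivity)
  have r3 : κ ≤ ε / 9 * s / L := by
    rw [le_div_iff₀ hL0]; linarith
  have e : y * (T * L⁻¹ - IT + IK) = y * (T * L⁻¹) + -(y * IT) + y * IK := by ring
  rw [e]
  have etot : ((nicolasBeta - 2 * (1 - ε / 3)) * s + 1) / L + C₁ * s / L ^ 2 + (C₂ * s / L ^ 2 + κ) =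
      (nicolasBeta - 2 + ε) * s / L - 3 * (ε / 9 * s / L) + (1 / L + (C₁ + C₂) * s / L ^ 2 + κ) := by
    field_simp
    ring
  linarith

/-- **Lower bound under RH**: for every `ε > 0`, `y ∫_y^∞ (π − li)/t² ≥ −(B₁ + 2 + ε)√y/log y` for all large `y`
(the inequality `2 − B₁ ≤ liminf f₂` of (1.2), in the form needed for the window).
[cite: Zhao2025MertensMean, §1.1 (1.2) and §2 (proof of Cor 1)] -/
theorem eventually_le_mul_piLiTail_of_RH (hRH : RiemannHypothesis) {ε : ℝ} (hε : 0 < ε) :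
    ∀ᶠ y : ℝ in atTop,
      -(nicolasBeta + 2 + ε) * Real.sqrt y / Real.log y ≤
        y * ∫ t in Ioi y, ((Nat.primeCounting ⌊t⌋₊ : ℝ) - logIntegral t) / t ^ 2 := by
  obtain ⟨C₁, hC₁0, hC₁⟩ := exists_abs_integral_tail_mul_le_of_RH hRH
  obtain ⟨C₂, hC₂0, y₀, hy₀2, hC₂⟩ := exists_abs_integral_piLiKernel_sub_le_of_RH hRH
  set κ : ℝ := |2 / Real.log 2 - logIntegral 2| with hκ
  have hκ0 : 0 ≤ κ := abs_nonneg _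
  have hε3 : 0 < ε / 3 := by positivity
  have hL2 : 0 ≤ Real.log (2 * π) := Real.log_nonneg (by linarith [Real.pi_gt_three])
  -- `ψ − θ ≤ (1 + ε/3)√t` beyond `T₁`
  obtain ⟨T₁, hT₁⟩ := (eventually_psi_sub_theta_le hε3).exists_forall_of_atTop
  filter_upwards [eventually_ge_atTop (max T₁ 2), eventually_ge_atTop y₀,
    eventually_mul_log_le_mul_sqrt hκ0 (by positivity : 0 < ε / 9),
    tendsto_sqrt_atTop.eventually_ge_atTop (9 * Real.log (2 * π) / ε),
    Real.tendsto_log_atTop.eventually_ge_atTop (9 * (C₁ + C₂) / ε)] with y hyT hyy₀ hyl hsε hLε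
  have hy2 : 2 ≤ y := (le_max_right _ _).trans hyT
  have hy0 : 0 < y := by linarith
  set s : ℝ := Real.sqrt y with hs
  set L : ℝ := Real.log y with hL
  have hs0 : 0 < s := Real.sqrt_pos.2 hy0
  have hL0 : 0 < L := Real.log_pos (by linarith)
  have hyss : y = s * s := (Real.mul_self_sqrt hy0.le).symm
  set T : ℝ := ∫ t in Ioi y, (θ t - t) / t ^ 2 with hT
  set IT : ℝ := ∫ t in Ioi y, (∫ u in Ioi t, (θ u - u) / u ^ 2) * (t⁻¹ / Real.log t ^ 2) with hIT
  set IK : ℝ := ∫ t in Ioi y, (((Nat.primeCounting ⌊t⌋₊ : ℝ) - logIntegral t) / t ^ 2 -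
    (θ t - t) / t ^ 2 * (Real.log t)⁻¹) with hIK
  rw [piLiTail_eq hy2]
  have hTy : -((nicolasBeta + 2 * (1 + ε / 3)) * s) - Real.log (2 * π) ≤ y * T :=
    neg_mul_tail_le_of_RH hRH (κ := 1 + ε / 3) hy2 (fun t ht => hT₁ t ((le_max_left _ _).trans (hyT.trans ht)))
  have hITb : |IT| ≤ C₁ / (s * L ^ 2) := hC₁ y hy2
  have hIKb : |IK| ≤ C₂ / (s * L ^ 2) + κ / y := hC₂ y hyy₀
  have h1 : (-((nicolasBeta + 2 * (1 + ε / 3)) * s) - Real.log (2 * π)) / L ≤ y * (T * L⁻¹) := by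
    rw [← mul_assoc, ← div_eq_mul_inv]
    exact div_le_div_of_nonneg_right hTy hL0.le
  have h2 : y * IT ≤ C₁ * s / L ^ 2 := by
    have : IT ≤ C₁ / (s * L ^ 2) := (le_abs_self IT).trans hITb
    calc y * IT ≤ y * (C₁ / (s * L ^ 2)) := mul_le_mul_of_nonneg_left this hy0.le
      _ = C₁ * s / L ^ 2 := by rw [hyss]; field_simp
  have h3 : -(y * IK) ≤ C₂ * s / L ^ 2 + κ := by
    have : -IK ≤ C₂ / (s * L ^ 2) + κ / y := (neg_le_abs IK).trans hIKb
    calc -(y * IK) = y * (-IK) := by ring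
      _ ≤ y * (C₂ / (s * L ^ 2) + κ / y) := mul_le_mul_of_nonneg_left this hy0.le
      _ = C₂ * s / L ^ 2 + κ := by rw [hyss]; field_simp
  have r1 : Real.log (2 * π) / L ≤ ε / 9 * s / L := by
    refine div_le_div_of_nonneg_right ?_ hL0.le
    have h := mul_le_mul_of_nonneg_left hsε hε3.le
    have e : ε / 3 * (9 * Real.log (2 * π) / ε) = 3 * Real.log (2 * π) := by field_simp; ring
    rw [e] at h
    linarith
  have r2 : (C₁ + C₂) * s / L ^ 2 ≤ ε / 9 * s / L := by
    have h : C₁ + C₂ ≤ ε / 9 * L := by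
      rw [div_le_iff₀ hε] at hLε
      linarith
    have e1 : (C₁ + C₂) * s / L ^ 2 = (C₁ + C₂) * (s / L ^ 2) := by ring
    have e2 : ε / 9 * s / L = (ε / 9 * L) * (s / L ^ 2) := by field_simp
    rw [e1, e2]
    exact mul_le_mul_of_nonneg_right h (by positivity)
  have r3 : κ ≤ ε / 9 * s / L := by
    rw [le_div_iff₀ hL0]; linarith
  have e : y * (T * L⁻¹ - IT + IK) = y * (T * L⁻¹) - y * IT - -(y * IK) := by ring
  rw [e]
  have etot : (-((nicolasBeta + 2 * (1 + ε / 3)) * s) - Real.log (2 * π)) / L - C₁ * s / L ^ 2 - (C₂ * s / L ^ 2 + κ) =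
      -(nicolasBeta + 2 + ε) * s / L + 3 * (ε / 9 * s / L) -
        (Real.log (2 * π) / L + (C₁ + C₂) * s / L ^ 2 + κ) := by
    field_simp
    ring
  linarith

/-! ### `E₂` on intervals and the window identity -/

/-- `E₂` is measurable (`Σ_{p≤x} 1/p` depends on `⌊x⌋` only). [cite: Zhao2025MertensMean, §1.1 (definition of E₂)] -/
theorem measurable_E₂ : Measurable E₂ := by
  have h : Measurable Mertens.primeRecipSum := by
    have : Mertens.primeRecipSum = (fun n : ℕ => ∑ p ∈ Nat.primesLE n, (p : ℝ)⁻¹) ∘ Nat.floor := by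
      funext t; rfl
    rw [this]
    exact (measurable_from_nat (f := fun n : ℕ => ∑ p ∈ Nat.primesLE n, (p : ℝ)⁻¹)).comp Nat.measurable_floor
  have : E₂ = fun x => Mertens.primeRecipSum x - Real.log (Real.log x) - Mertens.meisselMertens := by
    funext x; rfl
  rw [this]
  exact (h.sub (Real.measurable_log.comp Real.measurable_log)).sub measurable_const

/-- `|E₂(x)| ≤ 8/log 2` for `x ≥ 2` (the tree's `Mertens.abs_primeRecipSum_sub_le`: `|E₂(x)| ≤ 8/log x`).
[cite: Zhao2025MertensMean, §1.1 («E₂(x) = O(1/log x)»)] -/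
theorem abs_E₂_le {x : ℝ} (hx : 2 ≤ x) : |E₂ x| ≤ 8 / Real.log 2 := by
  have h := Mertens.abs_primeRecipSum_sub_le hx
  have hl : Real.log 2 ≤ Real.log x := Real.log_le_log two_pos hx
  exact h.trans (div_le_div_of_nonneg_left (by norm_num) (Real.log_pos one_lt_two) hl)

/-- `E₂` is integrable on every `[a, b] ⊂ [2, ∞)`. [cite: Zhao2025MertensMean, §1.1 (definition of E₂)] -/
theorem intervalIntegrable_E₂ {a b : ℝ} (ha : 2 ≤ a) (hab : a ≤ b) : IntervalIntegrable E₂ volume a b := by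
  rw [intervalIntegrable_iff_integrableOn_Ioc_of_le hab]
  refine Measure.integrableOn_of_bounded (M := 8 / Real.log 2) measure_Ioc_lt_top.ne
    measurable_E₂.aestronglyMeasurable ?_
  rw [ae_restrict_iff' measurableSet_Ioc]
  refine Eventually.of_forall fun x hx => ?_
  rw [Real.norm_eq_abs]
  exact abs_E₂_le (ha.trans hx.1.le)

/-- **`∫_{cX}^X E₂ = cX·T₂(cX) − X·T₂(X)`** by (2.5) at `X` and at `cX` (`2 ≤ cX ≤ X`), `T₂(y) = ∫_y^∞ (π − li)/t²`.
[cite: Zhao2025MertensMean, §2 (2.5) and proof of Cor 1] -/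
theorem integral_window_E₂_eq {c X : ℝ} (hcX : 2 ≤ c * X) (hc1 : c * X ≤ X) :
    ∫ x in (c * X)..X, E₂ x =
      c * X * (∫ t in Ioi (c * X), ((Nat.primeCounting ⌊t⌋₊ : ℝ) - logIntegral t) / t ^ 2) -
        X * ∫ t in Ioi X, ((Nat.primeCounting ⌊t⌋₊ : ℝ) - logIntegral t) / t ^ 2 := by
  have hX : 2 ≤ X := hcX.trans hc1
  rw [← intervalIntegral.integral_interval_sub_left (intervalIntegrable_E₂ le_rfl hX)
    (intervalIntegrable_E₂ le_rfl hcX), integral_E₂_eq hX, integral_E₂_eq hcX]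
  ring

/-! ### Corollary 1 (`i = 2`) -/

/-- **Zhao 2025, Corollary 1 for `i = 2`, PROVED, quantitative form**: under RH, for every
`0 < c < ((2 − B₁)/(2 + B₁))²` there is `κ > 0` (`κ = D/4`, `D = (2 − B₁) − (2 + B₁)√c`) with
`∫_{cX}^X E₂(x) dx ≥ κ √X/log X` for all large `X` (`B₁ = nicolasBeta`). [cite: Zhao2025MertensMean, Cor 1 (i = 2)] -/
theorem exists_eventually_le_integral_window_E₂_of_RH (hRH : RiemannHypothesis) {c : ℝ} (hc0 : 0 < c)
    (hc : c < ((2 - nicolasBeta) / (2 + nicolasBeta)) ^ 2) :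
    ∃ κ : ℝ, 0 < κ ∧ ∀ᶠ X : ℝ in atTop, κ * Real.sqrt X / Real.log X ≤ ∫ x in (c * X)..X, E₂ x := by
  have hβ0 : 0 < nicolasBeta := by linarith [nicolasBeta_gt]
  have hβ2 : nicolasBeta < 2 := by linarith [nicolasBeta_lt']
  have hq0 : 0 ≤ (2 - nicolasBeta) / (2 + nicolasBeta) := div_nonneg (by linarith) (by linarith)
  have hq1 : (2 - nicolasBeta) / (2 + nicolasBeta) ≤ 1 := by
    rw [div_le_one (by linarith)]; linarith
  have hc1 : c < 1 := lt_of_lt_of_le hc (by nlinarith)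
  obtain ⟨r, hr⟩ : ∃ r : ℝ, r = Real.sqrt c := ⟨_, rfl⟩
  have hr0 : 0 < r := by rw [hr]; exact Real.sqrt_pos.2 hc0
  have hrlt : r < (2 - nicolasBeta) / (2 + nicolasBeta) := by
    rw [hr, ← Real.sqrt_sq hq0]
    exact Real.sqrt_lt_sqrt hc0.le hc
  obtain ⟨D, hD⟩ : ∃ D : ℝ, D = (2 - nicolasBeta) - (2 + nicolasBeta) * r := ⟨_, rfl⟩
  have hDpos : 0 < D := by
    have : r * (2 + nicolasBeta) < 2 - nicolasBeta := by rwa [lt_div_iff₀ (by linarith)] at hrlt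
    rw [hD]; linarith
  obtain ⟨ε, hε⟩ : ∃ ε : ℝ, ε = D / (4 * (1 + r)) := ⟨_, rfl⟩
  have hεpos : 0 < ε := by rw [hε]; positivity
  have hεD : ε + ε * r = D / 4 := by rw [hε]; field_simp
  obtain ⟨Y₁, hY₁⟩ := (eventually_mul_piLiTail_le_of_RH hRH hεpos).exists_forall_of_atTop
  obtain ⟨Y₂, hY₂⟩ := (eventually_le_mul_piLiTail_of_RH hRH hεpos).exists_forall_of_atTop
  set ℓ : ℝ := -Real.log c with hℓ
  have hℓ0 : 0 ≤ ℓ := by rw [hℓ, neg_nonneg]; exact Real.log_nonpos hc0.le hc1.le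
  set A₂ : ℝ := (nicolasBeta + 2 + ε) * r with hA₂
  have hA₂0 : 0 ≤ A₂ := by positivity
  refine ⟨D / 4, by positivity, ?_⟩
  filter_upwards [eventually_ge_atTop (max Y₁ 2), eventually_ge_atTop (max Y₂ 2 / c),
    Real.tendsto_log_atTop.eventually_ge_atTop ((2 * A₂ / D + 1) * ℓ + 1)] with X hX1 hX2 hXL
  have hX2' : max Y₂ 2 ≤ c * X := by rw [div_le_iff₀ hc0] at hX2; linarith
  have hcX2 : 2 ≤ c * X := (le_max_right _ _).trans hX2'
  have hX2'' : 2 ≤ X := (le_max_right _ _).trans hX1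
  have hX0 : 0 < X := by linarith
  have hcXX : c * X ≤ X := by nlinarith
  set s : ℝ := Real.sqrt X with hs
  set L : ℝ := Real.log X with hL
  have hs0 : 0 < s := Real.sqrt_pos.2 hX0
  have hL0 : 0 < L := Real.log_pos (by linarith)
  have hsc : Real.sqrt (c * X) = r * s := by rw [hr, hs, Real.sqrt_mul hc0.le]
  have hlc : Real.log (c * X) = L - ℓ := by rw [Real.log_mul hc0.ne' hX0.ne', hℓ, hL]; ring
  have hℓL : ℓ ≤ (2 * A₂ / D + 1) * ℓ := by
    have h1 : (1 : ℝ) ≤ 2 * A₂ / D + 1 := by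
      have := div_nonneg (by positivity : (0 : ℝ) ≤ 2 * A₂) hDpos.le; linarith
    nlinarith
  have hM0 : 0 < L - ℓ := by linarith
  rw [integral_window_E₂_eq hcX2 hcXX]
  have hup := hY₁ X ((le_max_left _ _).trans hX1)
  have hlow := hY₂ (c * X) ((le_max_left _ _).trans hX2')
  rw [hsc, hlc] at hlow
  -- `A₂ s/(L − ℓ) ≤ (A₂ + D/2) s/L`
  have key : A₂ * s / (L - ℓ) ≤ (A₂ + D / 2) * s / L := by
    rw [div_le_div_iff₀ hM0 hL0]
    have h1 : (A₂ + D / 2) * ℓ ≤ D / 2 * L := by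
      have : (2 * A₂ / D + 1) * ℓ ≤ L := by linarith
      have e : (A₂ + D / 2) * ℓ = D / 2 * ((2 * A₂ / D + 1) * ℓ) := by field_simp
      rw [e]
      exact mul_le_mul_of_nonneg_left this (by positivity)
    nlinarith
  have hlow' : -(A₂ * s / (L - ℓ)) ≤ c * X * ∫ t in Ioi (c * X), ((Nat.primeCounting ⌊t⌋₊ : ℝ) - logIntegral t) / t ^ 2 := by
    have e : -(A₂ * s / (L - ℓ)) = -(nicolasBeta + 2 + ε) * (r * s) / (L - ℓ) := by rw [hA₂]; ring
    rw [e]; exact hlow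
  have hcoef : 2 - nicolasBeta - ε - A₂ = 3 * D / 4 := by
    rw [hA₂]; linear_combination -hD - hεD
  have hcoef' : (2 - nicolasBeta - ε - A₂) * (s / L) = 3 * D / 4 * (s / L) := by rw [hcoef]
  have e1 : (A₂ + D / 2) * s / L = A₂ * (s / L) + D / 2 * (s / L) := by ring
  have e2 : (nicolasBeta - 2 + ε) * Real.sqrt X / Real.log X = (nicolasBeta - 2 + ε) * (s / L) := by
    rw [hs, hL]; ring
  have e3 : D / 4 * s / L = D / 4 * (s / L) := by ring
  rw [e1] at key
  rw [e2] at hup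
  rw [e3]
  linarith [key, hup, hlow', hcoef']

/-- **Zhao 2025, Corollary 1 for `i = 2`, PROVED** (filter form): under RH, for every `0 < c < ((2 − B₁)/(2 + B₁))²`,
`∫_{cX}^X E₂(x) dx > 0` for all large `X` (`B₁ = nicolasBeta`). [cite: Zhao2025MertensMean, Cor 1 (i = 2)] -/
theorem eventually_integral_window_E₂_pos_of_RH (hRH : RiemannHypothesis) {c : ℝ} (hc0 : 0 < c)
    (hc : c < ((2 - nicolasBeta) / (2 + nicolasBeta)) ^ 2) :
    ∀ᶠ X : ℝ in atTop, 0 < ∫ x in (c * X)..X, E₂ x := by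
  obtain ⟨κ, hκ, h⟩ := exists_eventually_le_integral_window_E₂_of_RH hRH hc0 hc
  filter_upwards [h, eventually_gt_atTop (1 : ℝ)] with X hX hX1
  have : 0 < κ * Real.sqrt X / Real.log X :=
    div_pos (mul_pos hκ (Real.sqrt_pos.2 (by linarith))) (Real.log_pos hX1)
  linarith

/-- **Zhao 2025, Corollary 1 for `i = 2`, PROVED** in the shape of the named fact `Zhao2025MertensMean_cor1` (second
conjunct, `B₁ = 2 + γ − log 4π`): assuming RH, for every `0 < c < ((2 − B₁)/(2 + B₁))²` there is `X₀` with
`∫_{cX}^X E₂(x) dx > 0` for all `X ≥ X₀`. [cite: Zhao2025MertensMean, Cor 1 (i = 2)] -/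
theorem cor1_E₂_of_RH (hRH : RiemannHypothesis) {c : ℝ} (hc0 : 0 < c)
    (hc : c < ((2 - (2 + Real.eulerMascheroniConstant - Real.log (4 * π))) /
      (2 + (2 + Real.eulerMascheroniConstant - Real.log (4 * π)))) ^ 2) :
    ∃ X₀ : ℝ, ∀ X : ℝ, X₀ ≤ X → 0 < ∫ x in (c * X)..X, E₂ x := by
  have hβ : nicolasBeta = 2 + Real.eulerMascheroniConstant - Real.log (4 * π) := by
    rw [nicolasBeta, show (4 : ℝ) * π = 2 ^ 2 * π by norm_num, Real.log_mul (by positivity) Real.pi_pos.ne',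
      Real.log_pow]
    push_cast
    ring
  rw [← hβ] at hc
  exact (eventually_integral_window_E₂_pos_of_RH hRH hc0 hc).exists_forall_of_atTop

end Zhao2025

end Literature.NumberTheory.LFunctions
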